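import Literature.MathematicalPhysics.QuantumFieldTheory.Balaban1983to89.B9Thm34GCoarse
import Literature.MathematicalPhysics.QuantumFieldTheory.Balaban1983to89.B9Ineq366Vprime

/-!
# `Balaban1983to89.B9Thm34GConcreteC` — [Balaban1985BackgroundPropagators] Theorem 3.4 p. 400: the `(Q′G′²Q′*)⁻¹`-CLAUSE AND THE `G`-CLAUSE
# TOGETHER, concrete perturbation `U′ = e^{iηA}` — FILE 18's `B9Thm34GCoarse.thm34_G_clause_coarseLetters` with its three 𝔅-letter
# hypotheses for `C⁻¹(U′U)`, `C′(A)`, (3.67) (`h348'`, `h366`, `h367`) DISCHARGED by gen 9's `B9Ineq366Vprime.inverse_satisfies_thm32_vPrime`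
# («The inverse satisfies Theorem 3.2»), `hasMajorant_cPrimeHom_vPrime` ((3.66)) and the p. 403 expansion `eq365b_hom`: the remaining inputs about
# the coarse lattice are THEOREM 3.2 FOR `U` ALONE ((3.21) `C⁻¹ = (Q′G′²Q′*)⁻¹` exists, (3.48) kernel bound) and the (3.19)/(3.59) letters —
# FILE 19 of the Sect. B programme; with it every `A`-dependent object of pp. 400–407 entering `Δ_a(U′U)` is concrete (`V₃`, `P₁`, `P(U)`'s `G′(U′U)`-
# free word, `P′(A)` including `C⁻¹(U′U)` and `C′(A)`), modulo Theorems 3.1–3.3 for `U`, `P₂`'s (3.83) and the structural letters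

statement-level skeleton of published theorems with citation tags; proofs where landed; nothing here is a claim about the Yang–Mills mass gap

DOCFIX (cell `lit-balaban`, seat r06 gen 15, 2026-08-22; p37 `CITELOC-SWEEP-B4B9.md` §2b page-numeral slips, text layer re-read): (3.19) is p. 393 [PDF 5] ((3.20)–(3.25) p. 394); (3.57) is p. 401 [PDF 13] ((3.58)–(3.65) p. 402, (3.65)bis–(3.68) p. 403) — the locators of (3.19)/(3.21)/(3.25), (3.57)–(3.67) in this file corrected accordingly (3 place(s)); declarations, statements and proofs byte-identical to the tree copy of record (p316227).

CITATION HEADER (lean-in-tree rule).  B9 = T. Bałaban, *Propagators for lattice gauge theories in a background field*, Commun. Math. Phys.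
**99** (1985) 389–434 [Balaban1985BackgroundPropagators] (held `paper:balaban1985-cmp99-background-propagators`; journal page = PDF page + 388):
Thm 3.4 p. 400; p. 403 («thus the operators in the equality are invertible and an inverse of the left-hand side can be expressed by a Neumann
series convergent for α₁ sufficiently small. … The inverse satisfies Theorem 3.2 … These results imply that the operators R(U), P(U) = I − R(U)
extend analytically to the domain (3.37) and satisfy the same bounds with different constants only»); Thm 3.2 (3.48) p. 398; (3.19)/(3.21)/(3.25)
p. 394; (3.57)–(3.67) pp. 401–403; (3.42) p. 397; Thm 3.3 p. 399; (3.82)–(3.86) p. 407.  [4] = [Balaban1984PropagatorsII] Lemma 2.1 p. 234,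
(2.51)–(2.55) p. 232, (2.66) p. 234; [B11] = [Balaban1985Variational] (135) p. 298.  Cell `lit-balaban`, seat r06 (B9 fold owner) gen 12, FILE 19;
rows B9.Thm3.4 × B9.Thm3.2 × B9.Eq3.66 × B9.Eq3.62 × B9.Eq3.25 × B9.Eq3.68 × B9.Eq3.85.

WHAT THIS FILE PROVES (one theorem; 0 `def`; 0 sorry; standard axioms).
* **`thm34_G_clause_concreteC`** — hypotheses = FILE 18's with `{Linv Linv' Ccp}`, `h367`, `h348'`, `h366` replaced by: Theorem 3.2 for `U`
  (`hLinv : (Q′ ∘ G′² ∘ Q′*)·Linv = 1`, `h348` kernel bound at the Lemma-2.1 rate `δ₀`), the own rates of the `(Q′G′²Q′*)⁻¹`-chain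
  (`δ1` for Theorem 3.1's `G′(U)` entries — weakened inside to `δ_G` —, `(ρc, αc)` for its Neumann steps, `δ₀/2 + (α+β)δ₀ ≦ (1−αc)ρc`,
  `δ_G + (α+β)δ₀ ≦ (1−αc)ρc`, `δ_G ≦ δ1`, `δ_G ≦ δ₀`, `δ_G ≦ (1−α₃)(½−α_v)δ₀`), the devices of `B9Thm34Inv.inverse_satisfies_thm32` (`α_v ∈ (0,½)`,
  `α₃ < 1`, scale transfer of `(Lʲη)^{−4}` at `α_v` with constant `c₄`, (2.61) at `(δ₀, ½+α_v)`, `((½−α_v)δ₀, α₃)`, `(ρc, αc)`, positivity of the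
  `c₁`'s), the smallness `θ₃₆₃(δ1)c₁(ρc,αc) < 1` (`hθc`) and the EXPLICIT threshold `ha₁ : α₁ ≦ (2κ_C B₁c₄c₁(δ₀,½+α_v)·c₁((½−α_v)δ₀,α₃))⁻¹`
  with `κ_C = κ₃₆₆(…)` (`hκC`) and `B_c′ = 2B₁c₁((½−α_v)δ₀,α₃)` (`hBc'`) named as equations; block-local letters in the `κ·𝟙[y = y′]` form of
  `B9Ineq366Vprime`; strict signs `0 < κ_Q, c_F, B_G, B₁, δ₀`.  CONCLUSION: ∃ `C⁻¹(U′U)` (`Tinv`, two-sided inverse of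
  `Q′(U′U)G′²(U′U)Q′*(U′U)` on 𝔅, `G′(U′U) = gPrimeExtEnd G′ (V′G′)`) and ∃ `G(U′U)` (two-sided inverse of the concrete `Δ_a(U′U)` whose `P′(A)`
  carries `rep_! C⁻¹(U′U) rep*`), with every left and every right (3.42)-entry of Theorem 3.3 (FILE 16's constants).
  PROOF: `inverse_satisfies_thm32_vPrime` (⇒ `Tinv`, (3.48) at `(1−α₃)(½−α_v)δ₀`, weakened to `δ_G`), `hasMajorant_cPrimeHom_vPrime` at `δ_G`,
  `ineq363_op_vPrime` + `opNorm_lt_one_of_363_261` + `eq365_end(_left)` + `eq365b_hom` ⇒ `L′ = L + C′` ⇒ (3.67) `Tinv − Linv = −Tinv·C′·Linv`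
  (ring algebra with `L·Linv = 1`, `Tinv·L′ = 1`), then FILE 18.

HONEST SCOPE / NOT CLAIMED.  As FILE 18; the rate cascade is explicit and honest (the printed «with different constants only»): Theorem 3.1's
rate `δ1` ≧ `ρc` + …, the C-chain delivers `δ_G`, the (3.68)/(3.49) chains below it deliver `δ_P`, then `δ`, then `ρ`; no claim that the
printed `½δ₀` rates are attained simultaneously; no row head changes.  Remaining letters: Theorems 3.1–3.3 for `U` (by design: Theorem 3.1
per direction for `G′(U)`, Theorem 3.2 = `hLinv` + `h348`, Theorem 3.3 = `hG`/`hDG`/`hGD` + the entries fed to the universal clauses), `P₂`'s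
(3.83) (`B9Ineq385VG.ineq383_op`), structural block-locality / stencil / (3.35)/(3.37) shapes, the explicit threshold polynomials.

RELATED IN THE TREE, NOT DUPLICATED (searched 2026-08-22: `lean search 'thm34_G_clause' --decl` = ∅ besides FILE 18; the `…concreteC` hits are
unrelated `B11Ineq190*` declarations): FILES 15–18 and `B9Ineq366Vprime`/`B9Ineq363Vprime`/`B9Eq360Vprime` USED BY NAME.
-/

noncomputable section

namespace Literature.MathematicalPhysics.QuantumFieldTheory.Balaban1983to89.B9Thm34GConcreteC

open NormedSpace Complex
open Literature.MathematicalPhysics.QuantumFieldTheory.Balaban1983to89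
open Literature.MathematicalPhysics.QuantumFieldTheory.Balaban1983to89.B6RandomWalk (HasMajorant hasMajorant_mono Triangle254 Ineq261)
open Literature.MathematicalPhysics.QuantumFieldTheory.Balaban1983to89.B6RandomWalkHom (HasMajorantHom hasMajorantHom_mono hasMajorantHom_iff)
open Literature.MathematicalPhysics.QuantumFieldTheory.Balaban1983to89.B9Thm34Ext (toB6)
open Literature.MathematicalPhysics.QuantumFieldTheory.Balaban1983to89.B9Ineq347 (ScaleTransfer)
open Literature.MathematicalPhysics.QuantumFieldTheory.Balaban1983to89.B9Ineq366CPrime (hasMajorant_rate_mono)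
open Literature.MathematicalPhysics.QuantumFieldTheory.Balaban1983to89.B9Eq386Neumann (vTotal vThree pTwo deltaA eq384_sub)
open Literature.MathematicalPhysics.QuantumFieldTheory.Balaban1983to89.B9Ineq377POne (kappa377 kappa377_nonneg)
open Literature.MathematicalPhysics.QuantumFieldTheory.Balaban1983to89.B9Ineq385VG (kappa385 kappa385_nonneg gExt_leftEntry_of_386)
open Literature.MathematicalPhysics.QuantumFieldTheory.Balaban1983to89.B9Ineq386RightEntry (gExt_rightEntry_of_386L)
open Literature.MathematicalPhysics.QuantumFieldTheory.Balaban1983to89.B9Ineq386CommSum (ineq385_op_sum hasMajorant_GV_of_gradForm_comm_sum)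
open Literature.MathematicalPhysics.QuantumFieldTheory.Balaban1983to89.B9Eq39Adjoint
open Literature.MathematicalPhysics.QuantumFieldTheory.Balaban1983to89.B9Eq369Small (Through)
open Literature.MathematicalPhysics.QuantumFieldTheory.Balaban1983to89.B9Eq372Locality (stBonds)
open Literature.MathematicalPhysics.QuantumFieldTheory.Balaban1983to89.B9Eq352DivForm (tauF tauB)
open Literature.MathematicalPhysics.QuantumFieldTheory.Balaban1983to89.B9Eq352DivFormLetters
open Literature.MathematicalPhysics.QuantumFieldTheory.Balaban1983to89.B9Eq352GradLetters (diffLetter)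
open Literature.MathematicalPhysics.QuantumFieldTheory.Balaban1983to89.B9Eq371GradLetters (bT bU zeroLetter V1Letter)
open Literature.MathematicalPhysics.QuantumFieldTheory.Balaban1983to89.B9Eq375GradLetters (zeroLetter₂ V1Letter₂)
open Literature.MathematicalPhysics.QuantumFieldTheory.Balaban1983to89.B9Eq372RemLetters
open Literature.MathematicalPhysics.QuantumFieldTheory.Balaban1983to89.B9Eq382V3Letters
open Literature.MathematicalPhysics.QuantumFieldTheory.Balaban1983to89.B9Ineq385V3Concrete (cV385 cV0_nonneg cV385_nonneg)
open Literature.MathematicalPhysics.QuantumFieldTheory.Balaban1983to89.B9Eq373CurvComm (hasMajorant_comm_V₃_one)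
open Literature.MathematicalPhysics.QuantumFieldTheory.Balaban1983to89.B9Ineq386V3Concrete (norm_plaqU_adjacent_of_through)
open Literature.MathematicalPhysics.QuantumFieldTheory.Balaban1983to89.B9Eq376POneLetters
open Literature.MathematicalPhysics.QuantumFieldTheory.Balaban1983to89.B9Ineq377POneConcrete (ineq377_concreteE)
open Literature.MathematicalPhysics.QuantumFieldTheory.Balaban1983to89.B9Ineq349Hom (ineq349_hom)
open Literature.MathematicalPhysics.QuantumFieldTheory.Balaban1983to89.B9Ineq368PPrime (kappa349 kappa368)
open Literature.MathematicalPhysics.QuantumFieldTheory.Balaban1983to89.B9Ineq368PPrimeDs (kappa368Ds)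
open Literature.MathematicalPhysics.QuantumFieldTheory.Balaban1983to89.B9Eq360Vprime (gPrimeExtEnd)
open Literature.MathematicalPhysics.QuantumFieldTheory.Balaban1983to89.B9Eq360VprimeLetters (vPrimeConc cBConc cCConc)
open Literature.MathematicalPhysics.QuantumFieldTheory.Balaban1983to89.B9Ineq363Vprime (cVConc theta363 thetaL363)
open Literature.MathematicalPhysics.QuantumFieldTheory.Balaban1983to89.B9Ineq368Vprime (ineq368_op_conc ineq368_op_D_conc ineq368_op_Ds_conc
  ineq368_op_DDs_conc)
open Literature.MathematicalPhysics.QuantumFieldTheory.Balaban1983to89.B9Eq376DerivDict (hasMajorantHom_gradLin_comp hasMajorantHom_gradLin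
  hasMajorantHom_comp_divLin hasMajorantHom_divLin hasMajorant_gradLin_comp_comp_divLin)
open Literature.MathematicalPhysics.QuantumFieldTheory.Balaban1983to89.B9Thm34GConcrete (thm34_G_entries13_allConcrete)
open Literature.MathematicalPhysics.QuantumFieldTheory.Balaban1983to89.B9Thm34GEntries342 (thm34_G_entries342_allConcrete)
open Literature.MathematicalPhysics.QuantumFieldTheory.Balaban1983to89.B6RandomWalkSection
open Literature.MathematicalPhysics.QuantumFieldTheory.Balaban1983to89.B6RandomWalkHom (hasMajorantHom_zero)
open Literature.MathematicalPhysics.QuantumFieldTheory.Balaban1983to89.B9Thm34GCoarse (thm34_G_clause_coarseLetters)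
open Literature.MathematicalPhysics.QuantumFieldTheory.Balaban1983to89.B9Ineq366CPrime (cPrimeHom kappa366 kappa366_pos)
open Literature.MathematicalPhysics.QuantumFieldTheory.Balaban1983to89.B9Ineq366Vprime (eq365b_hom hasMajorant_cPrimeHom_vPrime
  inverse_satisfies_thm32_vPrime)
open Literature.MathematicalPhysics.QuantumFieldTheory.Balaban1983to89.B9Ineq363Vprime (cVConc_nonneg theta363_nonneg ineq363_op_vPrime)
open Literature.MathematicalPhysics.QuantumFieldTheory.Balaban1983to89.B9Eq360Vprime (eq365_end_left eq365_end opNorm_lt_one_of_363_261)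

section Assembly

variable {𝔸 : Type*} [NormedRing 𝔸] [NormedAlgebra ℂ 𝔸] [CompleteSpace 𝔸] {ι : Type} [Fintype ι]
variable (b : Module.Basis ι ℝ 𝔸) {S : Type} {κ : Type} [Fintype κ] [LinearOrder κ]
variable (T : κ → Equiv.Perm S) (U : κ → S → 𝔸ˣ)
variable {g : B9.Geometry} [Fintype g.Site] {Rr : ℝ} {H : Prop}

/-- **THEOREM 3.4, `(Q′G′²Q′*)⁻¹`-CLAUSE + `G`-CLAUSE, CONCRETE PERTURBATION** — «The inverse satisfies Theorem 3.2» for the concrete `V′(A)`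
and `G′(U′U)` (gen 9) feeding FILE 18: ∃ `C⁻¹(U′U)` two-sided inverse of `Q′(U′U)G′²(U′U)Q′*(U′U)` and ∃ `G(U′U)` two-sided inverse of the
concrete `Δ_a(U′U)` with every left/right (3.42)-entry of Theorem 3.3; inputs about the coarse lattice = Theorem 3.2 for `U` ((3.21), (3.48))
and the (3.19)/(3.59) letters only.
[cite: Balaban1985BackgroundPropagators, Thm 3.4 p.400 + Thm 3.2 (3.48) p.398 + p.403 + (3.57)–(3.67) pp.401–403 + (3.19) p.393/(3.21)/(3.25) p.394 + Thm 3.3 p.399 + (3.42) p.397 + (3.82)–(3.86) p.407 + (3.68) p.403 + (3.76)–(3.77) pp.405–406 + (3.37)/(3.35) p.396; Balaban1984PropagatorsII, Lemma 2.1 p.234 + (2.51)–(2.55) p.232 + (2.66) p.234; Balaban1985Variational, (135) p.298] -/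
theorem thm34_G_clause_concreteC [Fintype S] [DecidableEq S] [DecidableEq ι] [DecidableEq g.Site] (blk : S → g.Site) (d : ℕ)
    (δ₀ δ δP δG δ1 ρc αc αv α₃ c₄ α β ρ α' ρ₁ α'' Λ Λρ Λρ₁ B₀ κQ BG B₁ Bc' κC cF Cq a₀ κP κP' κ₁ κ₂ α₁ C₀ d₀ M₂ : ℝ)
    (kQ kF : g.Site → S → 𝔸 →L[ℝ] 𝔸) (sQ sF : S → 𝔸 →L[ℝ] 𝔸) (cfun w : g.Site → ℝ)
    (hB₀ : 0 ≤ B₀) (hκQ : 0 < κQ) (hBG : 0 < BG) (hB₁ : 0 < B₁) (hcF : 0 < cF) (hCq : 0 ≤ Cq) (ha₀ : 0 ≤ a₀) (hκP' : 0 ≤ κP') (hκ₂ : 0 ≤ κ₂) (hα₁ : 0 ≤ α₁) (hC₀ : 0 ≤ C₀) (hΛ : 1 ≤ Λ) (hΛρ : 0 ≤ Λρ)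
    (hρ : 0 ≤ ρ) (hα : 0 ≤ α) (hβ : 0 ≤ β) (hδ₀ : 0 < δ₀) (hδ : 0 ≤ δ) (hM₂ : 0 ≤ M₂) (hr : ρ + (α + β) * δ₀ ≤ δ)
    (hrP : δ + 2 * ((α + β) * δ₀) ≤ δP) (hrG : δP + (2 * α + β) * δ₀ ≤ δG)
    (hr1 : ρ₁ + (α + β) * δ₀ ≤ δG) (hα''1 : α'' ≤ 1) (hα''0 : 0 ≤ α'') (hρ₁ : 0 ≤ ρ₁) (hα''ρ : 0 ≤ (1 - α'') * ρ₁)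
    (hα''ρ2 : 0 ≤ (1 - 2 * α'') * ρ₁) (hα''ρ3 : 0 ≤ (1 - 3 * α'') * ρ₁) (hΛρ₁ : 0 ≤ Λρ₁)
    (hr368 : δP + 2 * ((2 * α + β) * δ₀) ≤ B9Ineq368Vprime.rateC α'' ρ₁)
    -- the (Q′G′²Q′*)⁻¹-clause chain (gen 6/9: `B9Ineq366Vprime.inverse_satisfies_thm32_vPrime`, `hasMajorant_cPrimeHom_vPrime`) has its OWN rates:
    -- Theorem 3.1 for `G′(U)` at `δ1`, its Neumann steps (3.63)/(3.64) at `(ρc, αc)`, (3.66) delivered at `δ_G`, (3.48) for `C⁻¹(U′U)` delivered at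
    -- `(1−α₃)(½−α_v)δ₀ ≧ δ_G`; Theorem 3.2 (3.48) for `U` at `δ₀ ≧ δ_G`
    (hrc1 : ρc + (α + β) * δ₀ ≤ δ1) (hρc : 0 ≤ ρc) (hαc0 : 0 ≤ αc) (hαc1 : αc ≤ 1)
    (hrc : δ₀ / 2 + (α + β) * δ₀ ≤ (1 - αc) * ρc) (hrcG : δG + (α + β) * δ₀ ≤ (1 - αc) * ρc) (hGδ1 : δG ≤ δ1) (hGδ₀ : δG ≤ δ₀)
    (hαv0 : 0 < αv) (hαv : αv < 1 / 2) (hα₃ : α₃ < 1) (hc₄ : 0 < c₄) (hrCinv : δG ≤ (1 - α₃) * ((1 / 2 - αv) * δ₀))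
    (hc₁v : 0 < B6.c1 d δ₀ (1 / 2 + αv)) (hc₁v' : 0 < B6.c1 d ((1 / 2 - αv) * δ₀) α₃) (hc₂ : 0 < B6.c1 d δ₀ β)
    (hcc' : 0 < B6.c1 d ρc αc)
    (hκC : κC = kappa366 κQ cF
      (kappa385 1 (cVConc (Fintype.card κ) 1 α₁ a₀ Cq M₂ (∑ i, ‖b i‖) (Real.exp (δ1 * d₀))) 0 0 Λ (B6.c1 d δ₀ β)) BG
      (BG * B6.c1 d ρc αc *
        (1 - theta363 (Fintype.card κ) 1 α₁ a₀ Cq M₂ (∑ i, ‖b i‖) (Real.exp (δ1 * d₀)) BG Λ (B6.c1 d δ₀ β) * B6.c1 d ρc αc)⁻¹)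
      Λ (B6.c1 d δ₀ β) α₁)
    (hBc' : Bc' = 2 * B₁ * B6.c1 d ((1 / 2 - αv) * δ₀) α₃)
    (ha₁ : α₁ ≤ (2 * (κC * B₁ * c₄ * B6.c1 d δ₀ (1 / 2 + αv)) * B6.c1 d ((1 / 2 - αv) * δ₀) α₃)⁻¹)
    (hκP : κP = kappa349 κQ ((1 + Fintype.card κ) * BG) B₁ Λ (B6.c1 d δ₀ β)) (hα' : α' ≤ 1) (hα'ρ0 : 0 ≤ α' * ρ) (hα'ρ2 : 0 ≤ (1 - 2 * α') * ρ)
    (hκ₁ : κ₁ = kappa377 (4 * (1 + Fintype.card κ) * (M₂ * ∑ i, ‖b i‖) * Real.exp (δP * d₀)) κP κP' Λ (B6.c1 d δ₀ β) α₁)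
    (hdnn : ∀ a a' : g.Site, 0 ≤ g.dist a a') (htri : Triangle254 (toB6 g Rr H)) (hrefl : ∀ y : g.Site, g.dist y y = 0)
    (hsym : ∀ y y' : g.Site, g.dist y y' = g.dist y' y) (hlen : ∀ y : g.Site, 0 < g.len y)
    (h261 : Ineq261 d (toB6 g Rr H) δ₀ β) (h261' : Ineq261 d (toB6 g Rr H) ρ α') (h261'' : Ineq261 d (toB6 g Rr H) ρ₁ α'')
    (h261c : Ineq261 d (toB6 g Rr H) ρc αc) (h261v : Ineq261 d (toB6 g Rr H) δ₀ (1 / 2 + αv))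
    (h261v' : Ineq261 d (toB6 g Rr H) ((1 / 2 - αv) * δ₀) α₃)
    (hT1 : ScaleTransfer g δ₀ α Λ (fun a => g.len a)) (hT2 : ScaleTransfer g δ₀ α Λ (fun a => g.len a ^ 2))
    (hT1i : ScaleTransfer g δ₀ α Λ (fun a => (g.len a)⁻¹)) (hT2i : ScaleTransfer g δ₀ α Λ (fun a => (g.len a ^ 2)⁻¹))
    (hT4 : ScaleTransfer g δ₀ α Λ (fun a => (g.len a ^ 4)⁻¹))
    (hTρ : ScaleTransfer g ρ α' Λρ (fun a => g.len a))
    (hTρ₁ : ScaleTransfer g ρ₁ α'' Λρ₁ (fun a => g.len a)) (hT4v : ScaleTransfer g δ₀ αv c₄ (fun y => g.len y ^ (-(4 : ℝ))))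
    (hsmall385 : kappa385 B₀
        (cV385 (Fintype.card κ) α₁ C₀ (M₂ * (∑ i, ‖b i‖) * Real.exp (δ * d₀))
          + ∑ _k ∈ (Finset.univ : Finset (κ ⊕ κ)),
            (10 + 8 * Fintype.card κ + (16 * Fintype.card κ + 12) * C₀) * (M₂ * (∑ i, ‖b i‖) * Real.exp (δ * d₀)))
        κ₁ κ₂ Λ (B6.c1 d δ₀ β) * α₁ * B6.c1 d ρ α' < 1)
    (hrepr : ∀ (v : 𝔸) (i : ι), |b.repr v i| ≤ M₂ * ‖v‖) (hη : 0 < g.eta) (hL : 1 ≤ g.L) (A : κ → S → 𝔸)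
    (hT : ∀ (μ ν : κ) (x : S), T μ (T ν x) = T ν (T μ x))
    (hsmall : ∀ y : g.Site, g.eta * (α₁ * (g.len y)⁻¹) ≤ 1 / 4)
    (hU1 : ∀ m z, ‖((U m z : 𝔸ˣ) : 𝔸)‖ ≤ 1 ∧ ‖(((U m z)⁻¹ : 𝔸ˣ) : 𝔸)‖ ≤ 1)
    -- (3.37) for the exponent field, blockwise, in the shapes files 1–10 read it
    (h337B : ∀ ν k x, ‖((g.eta : ℂ)⁻¹) • covDstar T U ν (A k) x‖ ≤ α₁ * (g.len (blk x) ^ 2)⁻¹)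
    (h337F : ∀ μ ν x, ‖((g.eta : ℂ)⁻¹) • covD T U μ (A ν) x‖ ≤ α₁ * (g.len (blk x) ^ 2)⁻¹)
    (h337B' : ∀ μ ν x, ‖((g.eta : ℂ)⁻¹) • covDstar T U ν (A ν) (T μ x)‖ ≤ α₁ * (g.len (blk x) ^ 2)⁻¹)
    (h337Bτ : ∀ μ x, ‖((g.eta : ℂ)⁻¹) • covDstar T U μ (tauB T U μ (A μ)) x‖ ≤ α₁ * (g.len (blk x) ^ 2)⁻¹)
    (h337FB : ∀ μ ν k x, ‖((g.eta : ℂ)⁻¹) • covD T U μ (A k) ((T ν).symm x)‖ ≤ α₁ * (g.len (blk x) ^ 2)⁻¹)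
    (hA : ∀ k x, ‖A k x‖ ≤ α₁ * (g.len (blk x))⁻¹) (hAτB : ∀ ν k x, ‖tauB T U ν (A k) x‖ ≤ α₁ * (g.len (blk x))⁻¹)
    (hAτF : ∀ μ k x, ‖tauF T U μ (A k) x‖ ≤ α₁ * (g.len (blk x))⁻¹)
    (hAFB : ∀ k μ ν x, ‖A k ((T ν).symm (T μ x))‖ ≤ α₁ * (g.len (blk x))⁻¹)
    (hAst : ∀ μ x m z, (m, z) ∈ stBonds T μ x → ‖A m z‖ ≤ α₁ * (g.len (blk x))⁻¹)
    (hAloc : ∀ μ x m z, (m, z) ∈ B9Eq375Locality.locBondsA T μ x → ‖A m z‖ ≤ α₁ * (g.len (blk x))⁻¹)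
    (hdAst : ∀ μ x m n y, Through T μ x m n y →
      ‖covD T U m (A n) y‖ ≤ g.eta * (α₁ * ((g.len (blk x))⁻¹) ^ 2) ∧
        ‖covD T U n (A m) y‖ ≤ g.eta * (α₁ * ((g.len (blk x))⁻¹) ^ 2))
    -- (3.35) on the plaquettes through each bond, at that bond's block scale
    (h35 : ∀ μ x m n y, Through T μ x m n y → ‖(plaqU T U m n y : 𝔸) - 1‖ ≤ C₀ * ((g.L ^ g.scale (blk x))⁻¹) ^ 2)
    -- stencil geometry
    (hd₀B : ∀ μ x, g.dist (blk x) (blk ((T μ).symm x)) ≤ d₀) (hd₀F : ∀ μ x, g.dist (blk x) (blk (T μ x)) ≤ d₀)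
    (hd₀FB : ∀ μ ν x, g.dist (blk x) (blk ((T ν).symm (T μ x))) ≤ d₀)
    (hd₀st : ∀ μ x (q : κ × S), q ∈ stBonds T μ x → g.dist (blk x) (blk q.2) ≤ d₀)
    (hd₀loc : ∀ μ x (q : κ × S), q ∈ B9Eq375Locality.locBondsA' T μ x → g.dist (blk x) (blk q.2) ≤ d₀)
    (hd₀0 : ∀ y : g.Site, g.dist y y ≤ d₀)
    -- Theorem 3.1 (3.42)₁,₂,₃ for `G′(U)` (site endomorphism `Gp`) with the DIRECTIONAL derivative letters (p. 398: the choice `∇`/`∇*` is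
    -- conventional), at the rate `δ1` (weakened inside to `δ_G` for the (3.49)/(3.68) chains)
    {Gp : Module.End ℝ (S × ι → ℝ)}
    (h342_1 : HasMajorant (g := toB6 g Rr H) (fun p : S × ι => blk p.1) Gp
      (fun a a' => BG * g.len a ^ 2 * Real.exp (-(δ1 * g.dist a a'))))
    (h342_2 : ∀ k : κ ⊕ κ, HasMajorant (g := toB6 g Rr H) (fun p : S × ι => blk p.1)
      (conj b (diffLetter T U ((g.eta : ℂ)⁻¹) k) * Gp) (fun a a' => BG * g.len a * Real.exp (-(δ1 * g.dist a a'))))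
    (h342_3 : ∀ k : κ ⊕ κ, HasMajorant (g := toB6 g Rr H) (fun p : S × ι => blk p.1)
      (Gp * conj b (diffLetter T U ((g.eta : ℂ)⁻¹) k)) (fun a a' => BG * g.len a * Real.exp (-(δ1 * g.dist a a'))))
    -- THE COARSE-LATTICE LETTERS IN THEIR OWN TYPING (carrier 𝔅 = `g.Site`, identity block map), read on the sites through a section `rep` of the
    -- block map (FILE 17 `B6RandomWalkSection`): `Q′`, `F′₂` : sites → 𝔅 and `Q′*`, `F′₂*` : 𝔅 → sites block-local ((3.19), (3.57), (3.59)),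
    -- `C⁻¹(U′U)`, `C′(A)` and (3.67) now DERIVED inside (`B9Ineq366Vprime`)
    (rep : g.Site → S × ι) (hrep : ∀ y : g.Site, blk (rep y).1 = y)
    {Qc Qc' Fc : (S × ι → ℝ) →ₗ[ℝ] (g.Site → ℝ)} {Qcs Qcs' Fcs : (g.Site → ℝ) →ₗ[ℝ] (S × ι → ℝ)}
    {Linv : Module.End ℝ (g.Site → ℝ)}
    (h357 : Qc' = Qc + Fc) (h357s : Qcs' = Qcs + Fcs)
    (hQc : HasMajorantHom (g := toB6 g Rr H) (fun p : S × ι => blk p.1) (fun y : g.Site => y) Qc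
      (fun a a' : g.Site => κQ * (if a = a' then (1 : ℝ) else 0)))
    (hQcs : HasMajorantHom (g := toB6 g Rr H) (fun y : g.Site => y) (fun p : S × ι => blk p.1) Qcs
      (fun a a' : g.Site => κQ * (if a = a' then (1 : ℝ) else 0)))
    (hFc : HasMajorantHom (g := toB6 g Rr H) (fun p : S × ι => blk p.1) (fun y : g.Site => y) Fc
      (fun a a' : g.Site => cF * α₁ * (if a = a' then (1 : ℝ) else 0)))
    (hFcs : HasMajorantHom (g := toB6 g Rr H) (fun y : g.Site => y) (fun p : S × ι => blk p.1) Fcs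
      (fun a a' : g.Site => cF * α₁ * (if a = a' then (1 : ℝ) else 0)))
    -- Theorem 3.2 for `U`: `C⁻¹ = (Q′G′²Q′*)⁻¹` ((3.21), `hLinv`) with the KERNEL bound (3.48) at the rate `δ₀`
    (hLinv : (Qc ∘ₗ (Gp * Gp) ∘ₗ Qcs) * Linv = 1)
    (h348 : ∀ y y' : g.Site, |B9Thm34Inv.ker (B9Thm34Inv.vol g d) Linv y y'| ≤
      B₁ * g.len y ^ (-(4 : ℝ)) * g.len y' ^ (-(d : ℝ)) * Real.exp (-(δ₀ * g.dist y y')))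
    (hθc : theta363 (Fintype.card κ) 1 α₁ a₀ Cq M₂ (∑ i, ‖b i‖) (Real.exp (δ1 * d₀)) BG Λ (B6.c1 d δ₀ β) *
      B6.c1 d ρc αc < 1)
    -- the data of the CONCRETE `V′(A)` of (3.60) (`B9Eq360VprimeLetters.vPrimeConc`): averaging kernels and their sizes ((3.19), (3.59)), the
    -- `a`-weights ((3.24)), and the two smallness conditions of `B9Ineq363Vprime` («for α₁ sufficiently small», p. 402)
    (hw : ∀ y, 0 ≤ w y) (hcard : ∀ y, ((B9Eq360Vprime.block blk y).card : ℝ) * w y ≤ 1)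
    (hkQ : ∀ y x, blk x = y → ‖kQ y x‖ ≤ w y) (hkF : ∀ y x, blk x = y → ‖kF y x‖ ≤ Cq * α₁ * w y)
    (hsQ : ∀ x, ‖sQ x‖ ≤ 1) (hsF : ∀ x, ‖sF x‖ ≤ Cq * α₁) (hcfun : ∀ y, |cfun y| ≤ a₀ * (g.len y ^ 2)⁻¹)
    (hθ : theta363 (Fintype.card κ) 1 α₁ a₀ Cq M₂ (∑ i, ‖b i‖) (Real.exp (δG * d₀)) BG Λ (B6.c1 d δ₀ β) *
      B6.c1 d ρ₁ α'' < 1)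
    (hθL : thetaL363 (Fintype.card κ) 1 α₁ a₀ Cq M₂ (∑ i, ‖b i‖) (Real.exp (δG * d₀)) BG Λ (B6.c1 d δ₀ β) *
      B6.c1 d ρ₁ α'' < 1)
    -- the constant `κ_{P′}` of the (3.77)-step dominates the four explicit (3.68)-constants of `B9Ineq368Vprime`
    (hK1 : kappa368 κQ cF
        (kappa385 1 (cVConc (Fintype.card κ) 1 α₁ a₀ Cq M₂ (∑ i, ‖b i‖) (Real.exp (δG * d₀))) 0 0 Λ (B6.c1 d δ₀ β))
        κC BG BG (BG * B6.c1 d ρ₁ α'' *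
          (1 - theta363 (Fintype.card κ) 1 α₁ a₀ Cq M₂ (∑ i, ‖b i‖) (Real.exp (δG * d₀)) BG Λ (B6.c1 d δ₀ β) * B6.c1 d ρ₁ α'')⁻¹)
        B₁ Bc' Λ (B6.c1 d δ₀ β) α₁ ≤ κP')
    (hK3 : Fintype.card κ * kappa368Ds κQ cF
        (kappa385 BG (cVConc (Fintype.card κ) 1 α₁ a₀ Cq M₂ (∑ i, ‖b i‖) (Real.exp (δG * d₀))) 0 0 Λ (B6.c1 d δ₀ β))
        κC BG BG BG (B6.c1 d ρ₁ α'' *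
          (1 - theta363 (Fintype.card κ) 1 α₁ a₀ Cq M₂ (∑ i, ‖b i‖) (Real.exp (δG * d₀)) BG Λ (B6.c1 d δ₀ β) * B6.c1 d ρ₁ α'')⁻¹)
        (BG * Λρ₁ ^ 2 * B6.c1 d ρ₁ α'' *
          (1 - thetaL363 (Fintype.card κ) 1 α₁ a₀ Cq M₂ (∑ i, ‖b i‖) (Real.exp (δG * d₀)) BG Λ (B6.c1 d δ₀ β) * B6.c1 d ρ₁ α'')⁻¹)
        B₁ Bc' (cBConc (Fintype.card κ) M₂ (∑ i, ‖b i‖) (Real.exp (B9Ineq368Vprime.rateC α'' ρ₁ * d₀)))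
        (cCConc (Fintype.card κ) 1 α₁ a₀ Cq M₂ (∑ i, ‖b i‖) (Real.exp (B9Ineq368Vprime.rateC α'' ρ₁ * d₀))) Λ (B6.c1 d δ₀ β) α₁
        ≤ κP')
    -- the abstract data of (3.80), the inverse property for the concrete `DRD*` and Theorem 3.3 for G(U)
    {G P₂ Qs Qs' Q Q' a F₂ F₂s : Module.End ℝ ((κ × S) × ι → ℝ)}
    (h380 : Q' = Q + F₂) (h380s : Qs' = Qs + F₂s) (hP₂def : P₂ = pTwo Qs Q F₂ F₂s a)
    (hΔG : deltaA (conj b (lapDDLetter T ((g.eta : ℂ)⁻¹) U)) (conj b (dPrimeLetter T U g.eta))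
      (conjHom b (gradLin T ((g.eta : ℂ)⁻¹) U) ∘ₗ (1 - (Gp ∘ₗ Qcs ∘ₗ Linv ∘ₗ Qc ∘ₗ Gp)) ∘ₗ conjHom b (divLin T ((g.eta : ℂ)⁻¹) U)) Qs a Q * G = 1)
    (hGΔ : G * deltaA (conj b (lapDDLetter T ((g.eta : ℂ)⁻¹) U)) (conj b (dPrimeLetter T U g.eta))
      (conjHom b (gradLin T ((g.eta : ℂ)⁻¹) U) ∘ₗ (1 - (Gp ∘ₗ Qcs ∘ₗ Linv ∘ₗ Qc ∘ₗ Gp)) ∘ₗ conjHom b (divLin T ((g.eta : ℂ)⁻¹) U)) Qs a Q = 1)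
    (hP₂ : HasMajorant (g := toB6 g Rr H) (fun q : (κ × S) × ι => blk q.1.2) P₂
      (fun a a' => κ₂ * α₁ * (g.len a ^ 2)⁻¹ * Real.exp (-(δ * g.dist a a'))))
    (hG : HasMajorant (g := toB6 g Rr H) (fun q : (κ × S) × ι => blk q.1.2) G
      (fun a a' => B₀ * g.len a ^ 2 * Real.exp (-(δ * g.dist a a'))))
    (hDG : ∀ k : κ ⊕ κ, HasMajorant (g := toB6 g Rr H) (fun q : (κ × S) × ι => blk q.1.2)
      (conj b (diffLetter (bT T) (bU U) ((g.eta : ℂ)⁻¹) k) * G) (fun a a' => B₀ * g.len a * Real.exp (-(δ * g.dist a a'))))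
    (hGD : ∀ k : κ ⊕ κ, HasMajorant (g := toB6 g Rr H) (fun q : (κ × S) × ι => blk q.1.2)
      (G * conj b (diffLetter (bT T) (bU U) ((g.eta : ℂ)⁻¹) k)) (fun a a' => B₀ * g.len a * Real.exp (-(δ * g.dist a a')))) :
    ∃ (Tinv : Module.End ℝ (g.Site → ℝ)) (GExt : Module.End ℝ ((κ × S) × ι → ℝ)),
      Tinv * (Qc' ∘ₗ ((gPrimeExtEnd Gp (conj b (vPrimeConc T U g.eta A blk kQ kF sQ sF cfun) * Gp)) * (gPrimeExtEnd Gp (conj b (vPrimeConc T U g.eta A blk kQ kF sQ sF cfun) * Gp))) ∘ₗ Qcs') = 1 ∧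
      (Qc' ∘ₗ ((gPrimeExtEnd Gp (conj b (vPrimeConc T U g.eta A blk kQ kF sQ sF cfun) * Gp)) * (gPrimeExtEnd Gp (conj b (vPrimeConc T U g.eta A blk kQ kF sQ sF cfun) * Gp))) ∘ₗ Qcs') * Tinv = 1 ∧
      deltaA (conj b (lapDDLetter T ((g.eta : ℂ)⁻¹) (prodCfg U g.eta A)))
          (conj b (dPrimeLetter T (prodCfg U g.eta A) g.eta))
          (conjHom b (gradLin T ((g.eta : ℂ)⁻¹) (prodCfg U g.eta A)) ∘ₗ (1 - ((Gp ∘ₗ Qcs ∘ₗ Linv ∘ₗ Qc ∘ₗ Gp) + (B9Eq360Vprime.pPrime Gp (gPrimeExtEnd Gp (conj b (vPrimeConc T U g.eta A blk kQ kF sQ sF cfun) * Gp)) (Qcs ∘ₗ secRes rep) (Qcs' ∘ₗ secRes rep) (secConj rep Linv) (secConj rep Tinv) (secExt rep ∘ₗ Qc) (secExt rep ∘ₗ Qc'))))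
            ∘ₗ conjHom b (divLin T ((g.eta : ℂ)⁻¹) (prodCfg U g.eta A))) Qs' a Q' * GExt = 1 ∧
      GExt *
      deltaA (conj b (lapDDLetter T ((g.eta : ℂ)⁻¹) (prodCfg U g.eta A)))
          (conj b (dPrimeLetter T (prodCfg U g.eta A) g.eta))
          (conjHom b (gradLin T ((g.eta : ℂ)⁻¹) (prodCfg U g.eta A)) ∘ₗ (1 - ((Gp ∘ₗ Qcs ∘ₗ Linv ∘ₗ Qc ∘ₗ Gp) + (B9Eq360Vprime.pPrime Gp (gPrimeExtEnd Gp (conj b (vPrimeConc T U g.eta A blk kQ kF sQ sF cfun) * Gp)) (Qcs ∘ₗ secRes rep) (Qcs' ∘ₗ secRes rep) (secConj rep Linv) (secConj rep Tinv) (secExt rep ∘ₗ Qc) (secExt rep ∘ₗ Qc'))))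
            ∘ₗ conjHom b (divLin T ((g.eta : ℂ)⁻¹) (prodCfg U g.eta A))) Qs' a Q' = 1 ∧
    (∀ (X : Module.End ℝ ((κ × S) × ι → ℝ)) (P : g.Site → ℝ), (∀ y, 0 ≤ P y) →
      HasMajorant (g := toB6 g Rr H) (fun q : (κ × S) × ι => blk q.1.2) (X * G)
        (fun a a' => B₀ * P a * Real.exp (-(δ * g.dist a a'))) →
      HasMajorant (g := toB6 g Rr H) (fun q : (κ × S) × ι => blk q.1.2) (X * GExt)
        (fun a a' => B₀ * B6.c1 d ρ α' *
          (1 - kappa385 B₀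
            (cV385 (Fintype.card κ) α₁ C₀ (M₂ * (∑ i, ‖b i‖) * Real.exp (δ * d₀))
              + ∑ _k ∈ (Finset.univ : Finset (κ ⊕ κ)),
                (10 + 8 * Fintype.card κ + (16 * Fintype.card κ + 12) * C₀) * (M₂ * (∑ i, ‖b i‖) * Real.exp (δ * d₀)))
            κ₁ κ₂ Λ (B6.c1 d δ₀ β) * α₁ * B6.c1 d ρ α')⁻¹ *
          P a * Real.exp (-((1 - α') * ρ * g.dist a a')))) ∧
    (∀ Y : Module.End ℝ ((κ × S) × ι → ℝ),
      HasMajorant (g := toB6 g Rr H) (fun q : (κ × S) × ι => blk q.1.2) (G * Y)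
        (fun a a' => B₀ * g.len a * Real.exp (-(δ * g.dist a a'))) →
      HasMajorant (g := toB6 g Rr H) (fun q : (κ × S) × ι => blk q.1.2) (GExt * Y)
        (fun a a' => B₀ * Λρ ^ 2 * B6.c1 d ρ α' *
          (1 - kappa385 B₀
            (cV385 (Fintype.card κ) α₁ C₀ (M₂ * (∑ i, ‖b i‖) * Real.exp (δ * d₀))
              + ∑ _k ∈ (Finset.univ : Finset (κ ⊕ κ)),
                (10 + 8 * Fintype.card κ + (16 * Fintype.card κ + 12) * C₀) * (M₂ * (∑ i, ‖b i‖) * Real.exp (δ * d₀)))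
            κ₁ κ₂ Λ (B6.c1 d δ₀ β) * α₁ * B6.c1 d ρ α')⁻¹ *
          g.len a * Real.exp (-((1 - 3 * α') * ρ * g.dist a a')))) := by
  -- signs, rates, the block-diagonal majorants in FILE 18's `if … then κ else 0` form
  have hSb : 0 ≤ ∑ i, ‖b i‖ := Finset.sum_nonneg fun i _ => norm_nonneg _
  have hΛ0 : 0 < Λ := zero_lt_one.trans_le hΛ
  have hαβ : 0 ≤ (α + β) * δ₀ := mul_nonneg (add_nonneg hα hβ) hδ₀.le
  have h2αβ : 0 ≤ (2 * α + β) * δ₀ := mul_nonneg (add_nonneg (mul_nonneg zero_le_two hα) hβ) hδ₀.le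
  have hδP0 : 0 ≤ δP := le_trans (add_nonneg hδ (mul_nonneg zero_le_two hαβ)) hrP
  have hδG0 : 0 ≤ δG := le_trans (le_trans hδP0 (le_add_of_nonneg_right h2αβ)) hrG
  have hδ1_0 : 0 ≤ δ1 := le_trans (add_nonneg hρc hαβ) hrc1
  have hαcρ : 0 ≤ (1 - αc) * ρc := mul_nonneg (sub_nonneg.mpr hαc1) hρc
  have hcV0 : 0 ≤ kappa385 1 (cVConc (Fintype.card κ) 1 α₁ a₀ Cq M₂ (∑ i, ‖b i‖) (Real.exp (δ1 * d₀))) 0 0 Λ (B6.c1 d δ₀ β) :=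
    kappa385_nonneg zero_le_one (cVConc_nonneg hα₁ ha₀ hCq hM₂ hSb (Real.exp_nonneg _)) le_rfl le_rfl hΛ0.le
      (B6RandomWalk.c1_nonneg d δ₀ β)
  have hθc0 : 0 ≤ theta363 (Fintype.card κ) 1 α₁ a₀ Cq M₂ (∑ i, ‖b i‖) (Real.exp (δ1 * d₀)) BG Λ (B6.c1 d δ₀ β) :=
    theta363_nonneg hα₁ ha₀ hCq hM₂ hSb (Real.exp_nonneg _) hBG.le hΛ0.le (B6RandomWalk.c1_nonneg d δ₀ β)
  have hB₁' : 0 < BG * B6.c1 d ρc αc *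
      (1 - theta363 (Fintype.card κ) 1 α₁ a₀ Cq M₂ (∑ i, ‖b i‖) (Real.exp (δ1 * d₀)) BG Λ (B6.c1 d δ₀ β) * B6.c1 d ρc αc)⁻¹ :=
    mul_pos (mul_pos hBG hcc') (inv_pos.mpr (by linarith))
  have hκC0 : 0 ≤ κC := by
    rw [hκC]; exact (kappa366_pos hκQ hcF hcV0 hB₁' hΛ0 hc₂ hα₁).le
  have hBc0 : 0 ≤ Bc' := by
    rw [hBc']; exact mul_nonneg (mul_nonneg zero_le_two hB₁.le) hc₁v'.le
  have hind : ∀ κ₀ : ℝ, (fun a a' : g.Site => κ₀ * (if a = a' then (1 : ℝ) else 0)) = fun a a' : g.Site => if a = a' then κ₀ else 0 :=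
    fun κ₀ => by
      funext a a'
      split_ifs <;> simp
  have hQc' := hQc
  have hQcs' := hQcs
  have hFc' := hFc
  have hFcs' := hFcs
  rw [hind] at hQc' hQcs' hFc' hFcs'
  have hw1 : ∀ a : g.Site, 0 ≤ g.len a := fun a => (hlen a).le
  have h342_1G : HasMajorant (g := toB6 g Rr H) (fun p : S × ι => blk p.1) Gp
      (fun a a' => BG * g.len a ^ 2 * Real.exp (-(δG * g.dist a a'))) :=
    hasMajorant_rate_mono (R := Rr) (H := H) _ BG (fun a => g.len a ^ 2) hBG.le (fun a => sq_nonneg _) hGδ1 hdnn h342_1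
  have h342_2G : ∀ k : κ ⊕ κ, HasMajorant (g := toB6 g Rr H) (fun p : S × ι => blk p.1)
      (conj b (diffLetter T U ((g.eta : ℂ)⁻¹) k) * Gp) (fun a a' => BG * g.len a * Real.exp (-(δG * g.dist a a'))) := fun k =>
    hasMajorant_rate_mono (R := Rr) (H := H) _ BG (fun a => g.len a) hBG.le hw1 hGδ1 hdnn (h342_2 k)
  have h342_3G : ∀ k : κ ⊕ κ, HasMajorant (g := toB6 g Rr H) (fun p : S × ι => blk p.1)
      (Gp * conj b (diffLetter T U ((g.eta : ℂ)⁻¹) k)) (fun a a' => BG * g.len a * Real.exp (-(δG * g.dist a a'))) := fun k =>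
    hasMajorant_rate_mono (R := Rr) (H := H) _ BG (fun a => g.len a) hBG.le hw1 hGδ1 hdnn (h342_3 k)
  -- the shapes `B9Ineq366Vprime`/`B9Ineq363Vprime` read (3.37)/stencil geometry in
  have hA' : ∀ μ x, ‖A μ x‖ ≤ α₁ * (g.len (blk x))⁻¹ ∧ ‖tauB T U μ (A μ) x‖ ≤ α₁ * (g.len (blk x))⁻¹ :=
    fun μ x => ⟨hA μ x, hAτB μ μ x⟩
  have h337s' : ∀ μ x, ‖((g.eta : ℂ)⁻¹) • covDstar T U μ (A μ) x‖ ≤ α₁ * (g.len (blk x) ^ 2)⁻¹ := fun μ x => h337B μ μ x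
  have hd₀' : ∀ μ x, g.dist (blk x) (blk (T μ x)) ≤ d₀ ∧ g.dist (blk x) (blk ((T μ).symm x)) ≤ d₀ :=
    fun μ x => ⟨hd₀F μ x, hd₀B μ x⟩
  set V := (conj b (vPrimeConc T U g.eta A blk kQ kF sQ sF cfun)) with hVdef
  set E := gPrimeExtEnd Gp (V * Gp) with hEdef
  -- «The inverse satisfies Theorem 3.2»: `C⁻¹(U′U)` for the concrete `V′(A)` and `G′(U′U)` (gen 9), threshold `ha₁`
  have ha₁' := ha₁
  rw [hκC] at ha₁'
  obtain ⟨Tinv, hTl, hTr, hTker⟩ := inverse_satisfies_thm32_vPrime (Rr := Rr) (H := H) b T U blk d hη A kQ kF sQ sF cfun w 1 d₀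
    M₂ Cq a₀ δ₀ δ1 α β ρc Λ BG α₁ αc κQ cF αv α₃ c₄ B₁ hBG hα₁ hΛ0 hρc hα hβ hδ₀ hδ1_0 hκQ hcF hαv0 hαv hα₃ hc₄ hB₁ hrc1
    hαc0 hαc1 hrc hc₁v hc₁v' hc₂ hcc' hdnn hrefl hsym htri hlen h261 h261c h261v h261v' hT1 hT2 hT4v hM₂ hrepr hsmall hA'
    h337s' hU1 hd₀' hd₀0 hw hcard hCq ha₀ hkQ hkF hsQ hsF hcfun hθc h342_1 h342_2 h357 h357s hQc hQcs hFc hFcs hLinv h348 ha₁'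
  -- (3.66) for the concrete `C′(A)` delivered at the rate `δ_G` (gen 9)
  have h366G : HasMajorant (g := toB6 g Rr H) (fun y : g.Site => y) (cPrimeHom Qc Fc Qcs Fcs Gp E V)
      (fun a a' => κC * α₁ * g.len a ^ 4 * Real.exp (-(δG * g.dist a a'))) := by
    rw [hκC]
    exact hasMajorant_cPrimeHom_vPrime (Rr := Rr) (H := H) b T U blk d hη A kQ kF sQ sF cfun w 1 d₀ M₂ Cq a₀ δ₀ δ1 α β ρc
      δG Λ BG α₁ αc κQ cF hBG.le hα₁ hΛ0.le hρc hδG0 hα hβ hδ₀.le hδ1_0 hκQ.le hcF.le hrc1 hαc0 hαc1 hrcG hdnn hrefl htri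
      hlen h261 h261c hT1 hT2 hM₂ hrepr hsmall hA' h337s' hU1 hd₀' hd₀0 hw hcard hCq ha₀ hkQ hkF hsQ hsF hcfun hθc h342_1
      h342_2 hQc hQcs hFc hFcs
  -- (3.63) ⇒ ‖V′G′‖ < 1 ⇒ both forms of (3.65) for `E` ⇒ the p. 403 expansion `L′ = L + C′(A)` ⇒ (3.67) on 𝔅
  have h363 := ineq363_op_vPrime (Rr := Rr) (H := H) b T U blk d hη A kQ kF sQ sF cfun w 1 d₀ M₂ Cq a₀ δ₀ δ1 α β ρc Λ BG
    α₁ hBG.le hα₁ hΛ0.le hρc hα hβ hδ₀.le hδ1_0 hrc1 hdnn htri hlen h261 hT1 hT2 hM₂ hrepr hsmall hA' h337s' hU1 hd₀' hd₀0 hw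
    hcard hCq ha₀ hkQ hkF hsQ hsF hcfun h342_1 h342_2
  have hW : ‖B9Eq360Vprime.toCLM (V * Gp)‖ < 1 :=
    opNorm_lt_one_of_363_261 (g := toB6 g Rr H) (fun p : S × ι => blk p.1) d ρc αc _ hθc0 hαcρ hdnn h261c hθc h363
  have h365l : E = Gp + Gp * V * E := eq365_end_left Gp V hW
  have h365r : E = Gp + E * V * Gp := by
    have h := eq365_end Gp (V * Gp) hW
    rwa [← mul_assoc] at h
  have h365 := eq365b_hom Qc Qc' Fc Qcs Qcs' Fcs Gp E V h357 h357s h365l h365r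
  have h367 : Tinv - Linv = -(Tinv * cPrimeHom Qc Fc Qcs Fcs Gp E V * Linv) := by
    have e1 : Tinv - Linv = Tinv * ((Qc ∘ₗ (Gp * Gp) ∘ₗ Qcs) * Linv) - Tinv * (Qc' ∘ₗ (E * E) ∘ₗ Qcs') * Linv := by
      rw [hLinv, hTl, mul_one, one_mul]
    rw [e1, h365, mul_add, add_mul, ← mul_assoc]
    abel
  -- the two kernel bounds at the rate `δ_G`
  have h348G : ∀ y y' : g.Site, |B9Thm34Inv.ker (B9Thm34Inv.vol g d) Linv y y'| ≤
      B₁ * g.len y ^ (-(4 : ℝ)) * g.len y' ^ (-(d : ℝ)) * Real.exp (-(δG * g.dist y y')) := fun y y' =>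
    (h348 y y').trans (mul_le_mul_of_nonneg_left
      (Real.exp_le_exp.mpr (neg_le_neg (mul_le_mul_of_nonneg_right hGδ₀ (hdnn y y'))))
      (mul_nonneg (mul_nonneg hB₁.le (Real.rpow_nonneg (hlen y).le _)) (Real.rpow_nonneg (hlen y').le _)))
  have h348T : ∀ y y' : g.Site, |B9Thm34Inv.ker (B9Thm34Inv.vol g d) Tinv y y'| ≤
      Bc' * g.len y ^ (-(4 : ℝ)) * g.len y' ^ (-(d : ℝ)) * Real.exp (-(δG * g.dist y y')) := fun y y' => by
    rw [hBc']
    exact (hTker y y').trans (mul_le_mul_of_nonneg_left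
      (Real.exp_le_exp.mpr (neg_le_neg (mul_le_mul_of_nonneg_right hrCinv (hdnn y y'))))
      (mul_nonneg (mul_nonneg (mul_nonneg (mul_nonneg zero_le_two hB₁.le) hc₁v'.le) (Real.rpow_nonneg (hlen y).le _))
        (Real.rpow_nonneg (hlen y').le _)))
  -- FILE 18: the G-clause with the coarse letters in their own typing
  obtain ⟨GExt, h1, h2, h3, h4⟩ := thm34_G_clause_coarseLetters (Rr := Rr) (H := H) b T U blk d δ₀ δ δP δG α β ρ α' ρ₁ α'' Λ Λρ Λρ₁ B₀ κQ BG B₁ Bc' κC cF Cq a₀ κP κP' κ₁ κ₂ α₁ C₀ d₀ M₂ kQ kF sQ sF cfun w hB₀ hκQ.le hBG.le hB₁.le hBc0 hκC0 hcF.le hCq ha₀ hκP' hκ₂ hα₁ hC₀ hΛ hΛρ hρ hα hβ hδ₀.le hδ hM₂ hr hrP hrG hr1 hα''1 hα''0 hρ₁ hα''ρ hα''ρ2 hα''ρ3 hΛρ₁ hr368 hκP hα' hα'ρ0 hα'ρ2 hκ₁ hdnn htri hrefl hsym hlen h261 h261' h261'' hT1 hT2 hT1i hT2i hT4 hTρ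 hTρ₁ hsmall385 hrepr hη hL A hT hsmall hU1 h337B h337F h337B' h337Bτ h337FB hA hAτB hAτF hAFB hAst hAloc hdAst h35 hd₀B hd₀F hd₀FB hd₀st hd₀loc hd₀0 h342_1G h342_2G h342_3G rep hrep h357 h357s h367 hQc' hQcs' hFc' hFcs' h348G h348T h366G hw hcard hkQ hkF hsQ hsF hcfun hθ hθL hK1 hK3 h380 h380s hP₂def hΔG hGΔ hP₂ hG hDG hGD
  exact ⟨Tinv, GExt, hTl, hTr, h1, h2, h3, h4⟩

end Assembly

end Literature.MathematicalPhysics.QuantumFieldTheory.Balaban1983to89.B9Thm34GConcreteC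

end
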